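import Summits.Ventures.HSemireg.WedgeHankelClassSpaceSl2Triple

/-!
# Venture HSemireg — THE SHEAR IS THE EXPONENTIAL OF THE RAISING OPERATOR: `SbC(1 λ 0 1) = Σ_{k ≤ n} (λ^k / k!) • e^k` on th-7's classes when `n!` is a unit in `K`
# (`e E_i = (i+1) E_{i+1}`; coordinates: `(λ^{a−i}/(a−i)!)·(i+1)⋯a = C(a,i) λ^{a−i}` = the Pascal entry of I9's `sbMat`), hence the shear commutes with `e`

HONEST FRAMING. Part of the Lean index of the computation cell `pub-hsemireg` (seat p10 gen 22, Sunday typer «UNIFORM-IN-n»).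
Finite-dimensional EXTERIOR ALGEBRA + linear algebra ONLY: no variety, no cohomology theory, no sheaf, no Ext group, no semiregularity map;
nothing here says that HC / HC_CM / HC_AV holds; no Literature fact is declared or used.  Custodian versions as in `WedgeHankelSiegelIdeal` (1/3) and `WedgeHankelFrameChange`;
the dictionary (the unipotent `(1 λ; 0 1) = exp(λ E₁₂)` acting on `Sym^n` through the divided powers of the raising operator) is QUOTED, never asserted.

WHAT IS IN THE TREE.  K27 (`WedgeHankelClassSpaceSl2Triple`): the raising operator `e` given on the spikes (`hE`, `hEtop`), `pow_raising_spikeBasis_of_le` / `_eq_zero` (`e^k E_i =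
(i+1)⋯(i+k) E_{i+k}`), `raising_pow_succ_eq_zero`; K3 `repr_SbC_spikeBasis` + I9 `sbMat_shear_apply` (`repr (SbC(1 λ 0 1) E_i) a = [i ≤ a] C(a,i) λ^{a−i}`); Mathlib
`Nat.ascFactorial_eq_factorial_mul_choose` (`(i+1)⋯(i+k) = k!·C(i+k,k)`).  K27's header left «`SbC(1 λ 0 1) = Σ_k (λ^k/k!) e^k`» as NOT typed.  THIS FILE (namespace
`Summit.Ventures.HSemireg.Wedge.HankelFrameChange` continued; imports K27):
* §334 **`repr_pow_raising_spikeBasis`** (`repr (e^k E_i) a = [a = i + k]·(i+1)⋯(i+k)`), `div_factorial_mul_ascFactorial` (`(λ^k/k!)·(i+1)⋯(i+k) = C(i+k,i)·λ^k` when `k! ≠ 0`).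
* §335 **`SbC_shear_eq_sum_pow_raising`: `SbC(1 λ 0 1) = Σ_{k ≤ n} (λ^k/k!) • e^k`** (`k! ≠ 0` in `K` for `k ≤ n`; both sides have the Pascal coordinates), `…_charZero`,
  **`commute_SbC_shear_raising`** (`SbC(1 λ 0 1)·e = e·SbC(1 λ 0 1)`), `SbC_shear_eq_one_add_sum_pow_raising` (`SbC(1 λ 0 1) = 1 + Σ_{1 ≤ k ≤ n} (λ^k/k!) • e^k`).
NOT typed here: the lower shear `SbC(1 0 c 1)` as `exp(c f)` (swap conjugation), characteristic `p ≤ n` (divided powers `e^{(k)}` would be needed), the logarithm; anything Ext-side.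
New names only.
-/

open Module

namespace Summit.Ventures.HSemireg.Wedge.HankelFrameChange

open Summit.Ventures.HSemireg.Wedge Summit.Ventures.HSemireg.Wedge.Kunneth Summit.Ventures.HSemireg.Wedge.Hankel
  Summit.Ventures.HSemireg.Wedge.BasisFree Summit.Ventures.HSemireg.Wedge.HankelSiegel Summit.Ventures.HSemireg.Wedge.HankelSiegelIdeal
  Summit.Ventures.HSemireg.Wedge.KunnethKernel Summit.Ventures.HSemireg.Wedge.HankelRankOne Summit.Ventures.HSemireg.Wedge.KernelDuality

variable (K : Type*) [Field K] {n : ℕ}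

section Exp

variable {e : Module.End K (spikeSpan K n)}
  (hE : ∀ (i : Fin (n + 1)) (hi : (i : ℕ) < n), e (spikeBasis K n i) = (((i : ℕ) : K) + 1) • spikeBasis K n ⟨(i : ℕ) + 1, by omega⟩) (hEtop : e (spikeBasis K n (Fin.last n)) = 0)
include hE hEtop

/-! ## §334. Coordinates of the powers of the raising operator -/

/-- **`repr (e^k E_i) a = (i+1)⋯(i+k)` if `a = i + k`, and `0` otherwise.** -/
theorem repr_pow_raising_spikeBasis (i a : Fin (n + 1)) (k : ℕ) :
    (spikeBasis K n).repr ((e ^ k) (spikeBasis K n i)) a = if (a : ℕ) = (i : ℕ) + k then ((((i : ℕ) + 1).ascFactorial k : ℕ) : K) else 0 := by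
  by_cases hik : (i : ℕ) + k ≤ n
  · rw [pow_raising_spikeBasis_of_le K hE i hik, map_smul, Finsupp.smul_apply, Basis.repr_self, Finsupp.single_apply, smul_eq_mul]
    by_cases ha : (a : ℕ) = (i : ℕ) + k
    · rw [if_pos (Fin.ext (by simp only; omega)), if_pos ha, mul_one]
    · rw [if_neg (fun h => ha (by rw [← h])), if_neg ha, mul_zero]
  · rw [pow_raising_spikeBasis_eq_zero K hE hEtop i (by omega), map_zero, Finsupp.zero_apply, if_neg (by have := a.2; omega)]

omit hE hEtop in
/-- the divided-power coefficient: `(λ^k / k!)·(i+1)⋯(i+k) = C(i+k, i)·λ^k` (`k! ≠ 0` in `K`). -/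
theorem div_factorial_mul_ascFactorial (lam : K) (i : ℕ) {k : ℕ} (hk : ((k.factorial : ℕ) : K) ≠ 0) :
    lam ^ k / (k.factorial : K) * (((i + 1).ascFactorial k : ℕ) : K) = ((i + k).choose i : K) * lam ^ k := by
  rw [Nat.ascFactorial_eq_factorial_mul_choose, Nat.cast_mul, Nat.choose_symm_add, div_mul_eq_mul_div, div_eq_iff hk]
  ring

/-! ## §335. The exponential -/

/-- **THE SHEAR IS THE EXPONENTIAL OF THE RAISING OPERATOR: `SbC(1 λ 0 1) = Σ_{k ≤ n} (λ^k / k!) • e^k`** when `k!` is a unit in `K` for every `k ≤ n` — on `E_i` both sides have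
`a`-coordinate `C(a,i)·λ^{a−i}` for `a ≥ i` and `0` below. -/
theorem SbC_shear_eq_sum_pow_raising (hfac : ∀ k ≤ n, ((k.factorial : ℕ) : K) ≠ 0) (lam : K) :
    SbC K 1 lam 0 1 = ∑ k : Fin (n + 1), (lam ^ (k : ℕ) / ((k : ℕ).factorial : K)) • e ^ (k : ℕ) := by
  refine (spikeBasis K n).ext fun i => ?_
  apply (spikeBasis K n).repr.injective
  ext a
  rw [repr_SbC_spikeBasis, sbMat_shear_apply, LinearMap.sum_apply, map_sum, Finsupp.finsetSum_apply]
  simp only [LinearMap.smul_apply, map_smul, Finsupp.smul_apply, smul_eq_mul, repr_pow_raising_spikeBasis K hE hEtop]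
  by_cases hia : (i : ℕ) ≤ (a : ℕ)
  · rw [if_pos hia, Finset.sum_eq_single (⟨(a : ℕ) - (i : ℕ), by omega⟩ : Fin (n + 1))]
    · simp only
      rw [if_pos (by omega), div_factorial_mul_ascFactorial K lam (i : ℕ) (hfac _ (by omega)), show (i : ℕ) + ((a : ℕ) - (i : ℕ)) = (a : ℕ) by omega]
    · intro k _ hk
      rw [if_neg, mul_zero]
      intro h
      exact hk (Fin.ext (by simp only; omega))
    · intro h; exact absurd (Finset.mem_univ _) h
  · rw [if_neg hia]
    refine (Finset.sum_eq_zero fun k _ => ?_).symm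
    rw [if_neg (by omega), mul_zero]

/-- characteristic `0`: `SbC(1 λ 0 1) = Σ_{k ≤ n} (λ^k / k!) • e^k` for every `n` and `λ`. -/
theorem SbC_shear_eq_sum_pow_raising_charZero [CharZero K] (lam : K) :
    SbC K 1 lam 0 1 = ∑ k : Fin (n + 1), (lam ^ (k : ℕ) / ((k : ℕ).factorial : K)) • e ^ (k : ℕ) :=
  SbC_shear_eq_sum_pow_raising K hE hEtop (fun k _ => Nat.cast_ne_zero.mpr (Nat.factorial_ne_zero k)) lam

/-- **the shear commutes with the raising operator** (`n!` a unit: it is a polynomial in `e`). -/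
theorem commute_SbC_shear_raising (hfac : ∀ k ≤ n, ((k.factorial : ℕ) : K) ≠ 0) (lam : K) : SbC K 1 lam 0 1 * e = e * SbC K 1 lam 0 1 := by
  rw [SbC_shear_eq_sum_pow_raising K hE hEtop hfac lam, Finset.sum_mul, Finset.mul_sum]
  exact Finset.sum_congr rfl fun k _ => by rw [smul_mul_assoc, mul_smul_comm, ← pow_succ, ← pow_succ']

/-- `SbC(1 λ 0 1) = 1 + Σ_{1 ≤ k ≤ n} (λ^k/k!) • e^k`: K1's `N = SbC(shear λ) − 1` is `λe` plus higher divided powers (`n!` a unit). -/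
theorem SbC_shear_eq_one_add_sum_pow_raising (hfac : ∀ k ≤ n, ((k.factorial : ℕ) : K) ≠ 0) (lam : K) :
    SbC K 1 lam 0 1 = 1 + ∑ k ∈ (Finset.univ : Finset (Fin (n + 1))).erase 0, (lam ^ (k : ℕ) / ((k : ℕ).factorial : K)) • e ^ (k : ℕ) := by
  rw [SbC_shear_eq_sum_pow_raising K hE hEtop hfac lam, ← Finset.add_sum_erase Finset.univ _ (Finset.mem_univ (0 : Fin (n + 1))), Fin.val_zero, pow_zero, pow_zero,
    Nat.factorial_zero, Nat.cast_one, div_one, one_smul]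

end Exp

end Summit.Ventures.HSemireg.Wedge.HankelFrameChange
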